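import Summits.QuantumFields.YangMills.Theorems.SwapVirialDeficitLaplaceAbelianLimit
import HarnessLib

/-!
# Abelian side of the small-ball ↔ Laplace dictionary, III: the LOGARITHMIC case `μ{G ≤ s} ∼ v·s^α·log(1/s)`
# (free-hands support of ⟨stmt-QuantumFields-24197⟩; for the `k = 4` commuting block `N₄(t) ∼ A·t⁶·log(1/t)` of fcl-p3 g44 / the BC5 rung
# ✓`stub_rung_zeroModeLog4` of ⟨24497⟩, whose Laplace twins carry ONE logarithm)

* §7 `abs_log_le_rpow_add` (`|log u| ≤ 2u^{−1/2} + u`), the finite log-moments `∫₀^∞ u^α|log u|e^{−u} du < ∞` (`α > 0`);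
* §8 the substitution identities `∫ s^α·log(βs)·β^{α+1}e^{−βs} ds = ∫ u^α log u e^{−u} du` (and with `|log|`);
* §9 ★★ `laplace_abelian_log_core` — if `|μ{G≤s} − v·s^α·log(s⁻¹)| ≤ ε·s^α·|log s| + C·s^{α+1}` for all `s > 0` then for `β ≥ 1`
  `|β^α·∫e^{−βG}dμ − v·Γ(α+1)·log β| ≤ ε·(Γ(α+1)·log β + c') + |v|·c' + C·Γ(α+2)·β⁻¹` (`c' = ∫u^α|log u|e^{−u}`);
* §10 ★★★ `tendsto_laplace_abelian_log` — `μ{G≤s}/(s^α·log(s⁻¹)) → v` (`s → 0⁺`) ⟹ `β^α·∫e^{−βG}dμ / log β → v·Γ(α+1)` (`β → ∞`).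
HONEST LABEL: pure real analysis / measure theory (plan-level glue); NOT the fixed-`L` sharp law, NOT ⟨24197⟩; the Yang–Mills mass gap is NOT proved;
no summit is proved by a line.  Width seat ym-line-sfw-p2-w2 g56 (cell ym-idea-1, free hands; own crux ⟨22884⟩ blocked-on ⟨19935⟩),
`--supports stmt-QuantumFields-24197`.  THEOREMS ONLY, standard axioms, 0 `sorry`.  References: [folklore] (Feller XIII.5; Bingham–Goldie–Teugels §1.7).
-/

set_option autoImplicit false

noncomputable section

open MeasureTheory Set Real Filter
open scoped ENNReal Topology
open Summit.QuantumFields.YangMills.Theorems.VirialFluxGap.ChebyshevGamma (integral_rpow_mul_exp_neg_mul_Ioi' integrableOn_rpow_mul_exp_neg_mul)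

namespace Summit.QuantumFields.YangMills.Theorems.SwapVirialDeficit.Abelian

variable {Ω : Type*} [MeasurableSpace Ω]

/-! ## §7 Log moments of the Gamma weight -/

/-- `|log u| ≤ 2u^{−1/2} + u` for `u > 0`. [folklore] -/
theorem abs_log_le_rpow_add {u : ℝ} (hu : 0 < u) : |Real.log u| ≤ 2 * u ^ (-(1/2 : ℝ)) + u := by
  have hp : 0 < u ^ (-(1/2 : ℝ)) := Real.rpow_pos_of_pos hu _
  rcases le_or_gt 1 u with h | h
  · rw [abs_of_nonneg (Real.log_nonneg h)]
    linarith [Real.log_le_sub_one_of_pos hu]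
  · have hneg : Real.log u < 0 := Real.log_neg hu h
    rw [abs_of_neg hneg]
    have h1 : Real.log (u ^ (-(1/2 : ℝ))) = -(1/2) * Real.log u := Real.log_rpow hu _
    have h2 : Real.log (u ^ (-(1/2 : ℝ))) ≤ u ^ (-(1/2 : ℝ)) - 1 := Real.log_le_sub_one_of_pos hp
    linarith

/-- The log-moment integrand is dominated: `u^α·|log u|·e^{−u} ≤ 2·(e^{−u}u^{(α+1/2)−1}) + e^{−u}u^{(α+2)−1}` on `u > 0`. [folklore] -/
theorem rpow_mul_abs_log_mul_exp_le {α u : ℝ} (hu : 0 < u) :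
    u ^ α * |Real.log u| * Real.exp (-u) ≤ 2 * (Real.exp (-u) * u ^ (α + 1/2 - 1)) + Real.exp (-u) * u ^ (α + 2 - 1) := by
  have h := abs_log_le_rpow_add hu
  have e1 : u ^ (α + 1/2 - 1) = u ^ α * u ^ (-(1/2 : ℝ)) := by rw [← Real.rpow_add hu]; ring_nf
  have e2 : u ^ (α + 2 - 1) = u ^ α * u := by rw [show α + 2 - 1 = α + 1 by ring, Real.rpow_add hu, Real.rpow_one]
  rw [e1, e2]
  have hα : 0 ≤ u ^ α := Real.rpow_nonneg hu.le _
  have hE : 0 ≤ Real.exp (-u) := (Real.exp_pos _).le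
  nlinarith [mul_le_mul_of_nonneg_left h (mul_nonneg hα hE)]

/-- ★ `u ↦ u^α·|log u|·e^{−u}` is integrable on `(0,∞)` for `α > 0`. [folklore] -/
theorem integrableOn_rpow_abs_log_exp {α : ℝ} (hα : 0 < α) :
    IntegrableOn (fun u : ℝ => u ^ α * |Real.log u| * Real.exp (-u)) (Ioi 0) := by
  have h1 : IntegrableOn (fun u : ℝ => 2 * (Real.exp (-u) * u ^ (α + 1/2 - 1)) + Real.exp (-u) * u ^ (α + 2 - 1)) (Ioi 0) :=
    ((Real.GammaIntegral_convergent (by linarith : 0 < α + 1/2)).const_mul 2).add (Real.GammaIntegral_convergent (by linarith : 0 < α + 2))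
  refine h1.mono' ?_ ((ae_restrict_iff' measurableSet_Ioi).2 (ae_of_all _ fun u hu => ?_))
  · have hm : Measurable fun u : ℝ => u ^ α * |Real.log u| * Real.exp (-u) :=
      ((measurable_id.pow_const α).mul Real.measurable_log.abs).mul (by fun_prop)
    exact hm.aestronglyMeasurable
  · have hu' : (0:ℝ) < u := hu
    have hnn : 0 ≤ u ^ α * |Real.log u| * Real.exp (-u) := by
      have : 0 ≤ u ^ α := Real.rpow_nonneg hu'.le _
      positivity
    rw [Real.norm_eq_abs, abs_of_nonneg hnn]
    exact rpow_mul_abs_log_mul_exp_le hu'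

/-- `u ↦ u^α·log u·e^{−u}` is integrable on `(0,∞)` for `α > 0`. [folklore] -/
theorem integrableOn_rpow_log_exp {α : ℝ} (hα : 0 < α) :
    IntegrableOn (fun u : ℝ => u ^ α * Real.log u * Real.exp (-u)) (Ioi 0) := by
  refine (integrableOn_rpow_abs_log_exp hα).mono' ?_ ((ae_restrict_iff' measurableSet_Ioi).2 (ae_of_all _ fun u hu => ?_))
  · exact (((measurable_id.pow_const α).mul Real.measurable_log).mul (by fun_prop)).aestronglyMeasurable
  · rw [Real.norm_eq_abs, abs_mul, abs_mul, abs_of_nonneg (Real.rpow_nonneg (le_of_lt hu) _), abs_of_pos (Real.exp_pos _)]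

/-- The absolute log moment `c'_α = ∫₀^∞ u^α|log u|e^{−u} du`. [folklore] -/
def logMomentAbs (α : ℝ) : ℝ := ∫ u in Ioi (0:ℝ), u ^ α * |Real.log u| * Real.exp (-u)

/-- The signed log moment `c_α = ∫₀^∞ u^α log u e^{−u} du` (`= Γ'(α+1)`). [folklore] -/
def logMoment (α : ℝ) : ℝ := ∫ u in Ioi (0:ℝ), u ^ α * Real.log u * Real.exp (-u)

/-- `c'_α ≥ 0`. [folklore] -/
theorem logMomentAbs_nonneg (α : ℝ) : 0 ≤ logMomentAbs α :=
  setIntegral_nonneg measurableSet_Ioi fun u hu => by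
    have : 0 ≤ u ^ α := Real.rpow_nonneg (le_of_lt hu) _
    positivity

/-- `|c_α| ≤ c'_α`. [folklore] -/
theorem abs_logMoment_le {α : ℝ} (hα : 0 < α) : |logMoment α| ≤ logMomentAbs α := by
  unfold logMoment logMomentAbs
  have h := norm_integral_le_of_norm_le (μ := volume.restrict (Ioi (0:ℝ))) (integrableOn_rpow_abs_log_exp hα)
    ((ae_restrict_iff' measurableSet_Ioi).2 (ae_of_all _ fun u (hu : 0 < u) =>
      (show ‖u ^ α * Real.log u * Real.exp (-u)‖ ≤ u ^ α * |Real.log u| * Real.exp (-u) by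
        rw [Real.norm_eq_abs, abs_mul, abs_mul, abs_of_nonneg (Real.rpow_nonneg hu.le _), abs_of_pos (Real.exp_pos _)])))
  rwa [Real.norm_eq_abs] at h

/-! ## §8 Substitutions `u = βs` -/

/-- `∫_{(0,∞)} s^α·log(βs)·(β^{α+1}e^{−βs}) ds = c_α` (`β > 0`). [folklore] -/
theorem integral_rpow_log_weight {α β : ℝ} (hβ : 0 < β) :
    ∫ s in Ioi (0:ℝ), s ^ α * Real.log (β * s) * (β ^ (α + 1) * Real.exp (-(β * s))) = logMoment α := by
  have e : ∀ s ∈ Ioi (0:ℝ), s ^ α * Real.log (β * s) * (β ^ (α + 1) * Real.exp (-(β * s))) =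
      β * ((fun u : ℝ => u ^ α * Real.log u * Real.exp (-u)) (β * s)) := by
    intro s hs
    have hs' : 0 ≤ s := le_of_lt hs
    simp only
    rw [Real.mul_rpow hβ.le hs', Real.rpow_add hβ, Real.rpow_one]; ring
  rw [setIntegral_congr_fun measurableSet_Ioi e, integral_const_mul, integral_comp_mul_left_Ioi (fun u : ℝ => u ^ α * Real.log u * Real.exp (-u)) 0 hβ,
    mul_zero, smul_eq_mul, ← mul_assoc, mul_inv_cancel₀ hβ.ne', one_mul]
  rfl

/-- `∫_{(0,∞)} s^α·|log(βs)|·(β^{α+1}e^{−βs}) ds = c'_α` (`β > 0`). [folklore] -/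
theorem integral_rpow_abs_log_weight {α β : ℝ} (hβ : 0 < β) :
    ∫ s in Ioi (0:ℝ), s ^ α * |Real.log (β * s)| * (β ^ (α + 1) * Real.exp (-(β * s))) = logMomentAbs α := by
  have e : ∀ s ∈ Ioi (0:ℝ), s ^ α * |Real.log (β * s)| * (β ^ (α + 1) * Real.exp (-(β * s))) =
      β * ((fun u : ℝ => u ^ α * |Real.log u| * Real.exp (-u)) (β * s)) := by
    intro s hs
    have hs' : 0 ≤ s := le_of_lt hs
    simp only
    rw [Real.mul_rpow hβ.le hs', Real.rpow_add hβ, Real.rpow_one]; ring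
  rw [setIntegral_congr_fun measurableSet_Ioi e, integral_const_mul, integral_comp_mul_left_Ioi (fun u : ℝ => u ^ α * |Real.log u| * Real.exp (-u)) 0 hβ,
    mul_zero, smul_eq_mul, ← mul_assoc, mul_inv_cancel₀ hβ.ne', one_mul]
  rfl

/-- Integrability of the two substituted integrands on `(0,∞)` (`β > 0`). [folklore] -/
theorem integrableOn_log_weights {α β : ℝ} (hα : 0 < α) (hβ : 0 < β) :
    IntegrableOn (fun s : ℝ => s ^ α * |Real.log (β * s)| * (β ^ (α + 1) * Real.exp (-(β * s)))) (Ioi 0) ∧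
      IntegrableOn (fun s : ℝ => s ^ α * Real.log (β * s) * (β ^ (α + 1) * Real.exp (-(β * s)))) (Ioi 0) := by
  have hF : IntegrableOn (fun s : ℝ => (fun u : ℝ => u ^ α * |Real.log u| * Real.exp (-u)) (β * s)) (Ioi 0) := by
    have h := (integrableOn_Ioi_comp_mul_left_iff (fun u : ℝ => u ^ α * |Real.log u| * Real.exp (-u)) 0 hβ).2
    rw [mul_zero] at h
    exact h (integrableOn_rpow_abs_log_exp hα)
  have hG : IntegrableOn (fun s : ℝ => (fun u : ℝ => u ^ α * Real.log u * Real.exp (-u)) (β * s)) (Ioi 0) := by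
    have h := (integrableOn_Ioi_comp_mul_left_iff (fun u : ℝ => u ^ α * Real.log u * Real.exp (-u)) 0 hβ).2
    rw [mul_zero] at h
    exact h (integrableOn_rpow_log_exp hα)
  constructor
  · refine IntegrableOn.congr_fun (hF.const_mul β) (fun s hs => ?_) measurableSet_Ioi
    have hs' : 0 ≤ s := le_of_lt hs
    simp only
    rw [Real.mul_rpow hβ.le hs', Real.rpow_add hβ, Real.rpow_one]; ring
  · refine IntegrableOn.congr_fun (hG.const_mul β) (fun s hs => ?_) measurableSet_Ioi
    have hs' : 0 ≤ s := le_of_lt hs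
    simp only
    rw [Real.mul_rpow hβ.le hs', Real.rpow_add hβ, Real.rpow_one]; ring

/-! ## §9 The core bound with one logarithm -/

/-- ★★ **LOG-ABELIAN CORE**: for a finite measure `μ`, a measurable `G ≥ 0`, `α > 0`, `ε ≥ 0`, and the global bound
`|μ{G ≤ s} − v·s^α·log(s⁻¹)| ≤ ε·s^α·|log s| + C·s^{α+1}` for all `s > 0`: for every `β ≥ 1`,
`|β^α·∫e^{−βG}dμ − v·Γ(α+1)·log β| ≤ ε·(Γ(α+1)·log β + c'_α) + |v|·c'_α + C·Γ(α+2)·β⁻¹`. [folklore] -/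
theorem laplace_abelian_log_core (μ : Measure Ω) [IsFiniteMeasure μ] {G : Ω → ℝ} (hG : Measurable G) (hG0 : ∀ ω, 0 ≤ G ω)
    {α v ε C : ℝ} (hα : 0 < α) (hε : 0 ≤ ε)
    (hm : ∀ s : ℝ, 0 < s → |(μ {ω | G ω ≤ s}).toReal - v * s ^ α * Real.log s⁻¹| ≤ ε * s ^ α * |Real.log s| + C * s ^ (α + 1))
    {β : ℝ} (hβ : 1 ≤ β) :
    |β ^ α * ∫ ω, Real.exp (-(β * G ω)) ∂μ - v * Real.Gamma (α + 1) * Real.log β| ≤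
      ε * (Real.Gamma (α + 1) * Real.log β + logMomentAbs α) + |v| * logMomentAbs α + C * Real.Gamma (α + 1 + 1) * β⁻¹ := by
  have hβ0 : 0 < β := by linarith
  have hlogβ : 0 ≤ Real.log β := Real.log_nonneg hβ
  set M : ℝ := (μ univ).toReal with hM
  set m : ℝ → ℝ := fun s => (μ {ω | G ω ≤ s}).toReal with hm_def
  have hm0 : ∀ s, 0 ≤ m s := fun s => ENNReal.toReal_nonneg
  have hmM : ∀ s, m s ≤ M := fun s => ENNReal.toReal_mono (measure_ne_top μ _) (measure_mono (subset_univ _))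
  have hmeas : Measurable m := ENNReal.measurable_toReal.comp (measurable_measure_le μ G)
  set w : ℝ → ℝ := fun s => β ^ (α + 1) * Real.exp (-(β * s)) with hw
  have hw0 : ∀ s, 0 ≤ w s := fun s => by positivity
  obtain ⟨hIabs, hIlog⟩ := integrableOn_log_weights hα hβ0
  have hI0 : IntegrableOn (fun s : ℝ => s ^ α * Real.exp (-(β * s))) (Ioi 0) := integrableOn_rpow_mul_exp_neg_mul (by linarith) hβ0
  have hI1 : IntegrableOn (fun s : ℝ => s ^ (α + 1) * Real.exp (-(β * s))) (Ioi 0) := integrableOn_rpow_mul_exp_neg_mul (by linarith) hβ0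
  -- the layer cake
  have hL : β ^ α * ∫ ω, Real.exp (-(β * G ω)) ∂μ = ∫ s in Ioi (0:ℝ), m s * w s := by
    rw [integral_exp_neg_mul_eq_layerCake μ hG hG0 hβ0, ← integral_const_mul]
    refine setIntegral_congr_fun measurableSet_Ioi fun s _ => ?_
    simp only [hm_def, hw]
    rw [Real.rpow_add hβ0, Real.rpow_one]; ring
  -- the model term `v Γ(α+1) log β = ∫ v s^α log β · w`
  have hΓ0 : ∫ s in Ioi (0:ℝ), s ^ α * w s = Real.Gamma (α + 1) := by
    have h := integral_moment_weight (K := 1) (α := α) (θ := 0) (by linarith) hβ0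
    simp only [add_zero, neg_zero, Real.rpow_zero, mul_one, one_mul] at h
    simpa only [hw] using h
  have hV : v * Real.Gamma (α + 1) * Real.log β = ∫ s in Ioi (0:ℝ), v * Real.log β * (s ^ α * w s) := by
    rw [integral_const_mul, hΓ0]; ring
  -- integrability
  have hIm : IntegrableOn (fun s : ℝ => m s * w s) (Ioi 0) := by
    have hb : IntegrableOn (fun s : ℝ => M * (β ^ (α + 1) * Real.exp (-(β * s)))) (Ioi 0) := by
      have h := ((exp_neg_integrableOn_Ioi 0 hβ0).const_mul (β ^ (α + 1))).const_mul M
      simp only [neg_mul] at h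
      exact h
    refine hb.mono' ((hmeas.mul (by fun_prop)).aestronglyMeasurable) (ae_of_all _ fun s => ?_)
    rw [Real.norm_eq_abs, abs_of_nonneg (mul_nonneg (hm0 s) (hw0 s))]
    exact mul_le_mul_of_nonneg_right (hmM s) (hw0 s)
  have hIv : IntegrableOn (fun s : ℝ => v * Real.log β * (s ^ α * w s)) (Ioi 0) := by
    have e : (fun s : ℝ => v * Real.log β * (s ^ α * w s)) = fun s => (v * Real.log β * β ^ (α + 1)) * (s ^ α * Real.exp (-(β * s))) := by
      funext s; simp only [hw]; ring
    rw [e]; exact hI0.const_mul _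
  -- the dominator of the difference
  have hdom : ∀ s ∈ Ioi (0:ℝ), ‖m s * w s - v * Real.log β * (s ^ α * w s)‖ ≤
      ε * (s ^ α * |Real.log (β * s)| * w s) + (ε * Real.log β) * (s ^ α * w s) + C * (s ^ (α + 1) * w s) + |v| * (s ^ α * |Real.log (β * s)| * w s) := by
    intro s hs
    have hs0 : 0 < s := hs
    have hsα : 0 ≤ s ^ α := Real.rpow_nonneg hs0.le _
    have hsplit : m s * w s - v * Real.log β * (s ^ α * w s) =
        (m s - v * s ^ α * Real.log s⁻¹) * w s - v * (s ^ α * Real.log (β * s) * w s) := by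
      rw [Real.log_inv, Real.log_mul hβ0.ne' hs0.ne']; ring
    rw [hsplit, Real.norm_eq_abs]
    have h1 : |(m s - v * s ^ α * Real.log s⁻¹) * w s| ≤ (ε * s ^ α * |Real.log s| + C * s ^ (α + 1)) * w s := by
      rw [abs_mul, abs_of_nonneg (hw0 s)]; exact mul_le_mul_of_nonneg_right (hm s hs0) (hw0 s)
    have h2 : |v * (s ^ α * Real.log (β * s) * w s)| = |v| * (s ^ α * |Real.log (β * s)| * w s) := by
      rw [abs_mul, abs_mul, abs_mul, abs_of_nonneg hsα, abs_of_nonneg (hw0 s)]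
    -- `|log s| ≤ |log(βs)| + log β`
    have h3 : |Real.log s| ≤ |Real.log (β * s)| + Real.log β := by
      have e : Real.log s = Real.log (β * s) - Real.log β := by rw [Real.log_mul hβ0.ne' hs0.ne']; ring
      rw [e]; refine (abs_sub _ _).trans ?_; rw [abs_of_nonneg hlogβ]
    calc |(m s - v * s ^ α * Real.log s⁻¹) * w s - v * (s ^ α * Real.log (β * s) * w s)|
        ≤ |(m s - v * s ^ α * Real.log s⁻¹) * w s| + |v * (s ^ α * Real.log (β * s) * w s)| := abs_sub _ _
      _ ≤ (ε * s ^ α * |Real.log s| + C * s ^ (α + 1)) * w s + |v| * (s ^ α * |Real.log (β * s)| * w s) := by rw [h2]; exact add_le_add h1 le_rfl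
      _ ≤ (ε * s ^ α * (|Real.log (β * s)| + Real.log β) + C * s ^ (α + 1)) * w s + |v| * (s ^ α * |Real.log (β * s)| * w s) := by
          have : ε * s ^ α * |Real.log s| ≤ ε * s ^ α * (|Real.log (β * s)| + Real.log β) := mul_le_mul_of_nonneg_left h3 (by positivity)
          nlinarith [hw0 s]
      _ = _ := by ring
  have hIdom : IntegrableOn (fun s : ℝ => ε * (s ^ α * |Real.log (β * s)| * w s) + (ε * Real.log β) * (s ^ α * w s) + C * (s ^ (α + 1) * w s) +
      |v| * (s ^ α * |Real.log (β * s)| * w s)) (Ioi 0) := by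
    have ha : IntegrableOn (fun s : ℝ => s ^ α * |Real.log (β * s)| * w s) (Ioi 0) := by simpa only [hw] using hIabs
    have hb : IntegrableOn (fun s : ℝ => s ^ α * w s) (Ioi 0) := by
      have e : (fun s : ℝ => s ^ α * w s) = fun s => β ^ (α + 1) * (s ^ α * Real.exp (-(β * s))) := by funext s; simp only [hw]; ring
      rw [e]; exact hI0.const_mul _
    have hc : IntegrableOn (fun s : ℝ => s ^ (α + 1) * w s) (Ioi 0) := by
      have e : (fun s : ℝ => s ^ (α + 1) * w s) = fun s => β ^ (α + 1) * (s ^ (α + 1) * Real.exp (-(β * s))) := by funext s; simp only [hw]; ring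
      rw [e]; exact hI1.const_mul _
    exact (((ha.const_mul ε).add (hb.const_mul _)).add (hc.const_mul C)).add (ha.const_mul |v|)
  rw [hL, hV, ← integral_sub hIm hIv]
  have hbound := norm_integral_le_of_norm_le hIdom ((ae_restrict_iff' measurableSet_Ioi).2 (ae_of_all _ hdom))
  rw [Real.norm_eq_abs] at hbound
  refine hbound.trans (le_of_eq ?_)
  -- evaluate the dominator integral
  have ha : IntegrableOn (fun s : ℝ => s ^ α * |Real.log (β * s)| * w s) (Ioi 0) := by simpa only [hw] using hIabs
  have hb : IntegrableOn (fun s : ℝ => s ^ α * w s) (Ioi 0) := by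
    have e : (fun s : ℝ => s ^ α * w s) = fun s => β ^ (α + 1) * (s ^ α * Real.exp (-(β * s))) := by funext s; simp only [hw]; ring
    rw [e]; exact hI0.const_mul _
  have hc : IntegrableOn (fun s : ℝ => s ^ (α + 1) * w s) (Ioi 0) := by
    have e : (fun s : ℝ => s ^ (α + 1) * w s) = fun s => β ^ (α + 1) * (s ^ (α + 1) * Real.exp (-(β * s))) := by funext s; simp only [hw]; ring
    rw [e]; exact hI1.const_mul _
  have hJabs : ∫ s in Ioi (0:ℝ), s ^ α * |Real.log (β * s)| * w s = logMomentAbs α := by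
    simpa only [hw] using integral_rpow_abs_log_weight hβ0
  have hJ1 : ∫ s in Ioi (0:ℝ), s ^ (α + 1) * w s = Real.Gamma (α + 1 + 1) * β⁻¹ := by
    have h := integral_moment_weight (K := 1) (α := α) (θ := 1) (by linarith) hβ0
    simp only [one_mul, Real.rpow_neg_one] at h
    simpa only [hw] using h
  have g1 : IntegrableOn (fun s : ℝ => ε * (s ^ α * |Real.log (β * s)| * w s)) (Ioi 0) := ha.const_mul ε
  have g2 : IntegrableOn (fun s : ℝ => (ε * Real.log β) * (s ^ α * w s)) (Ioi 0) := hb.const_mul _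
  have g3 : IntegrableOn (fun s : ℝ => C * (s ^ (α + 1) * w s)) (Ioi 0) := hc.const_mul C
  have g4 : IntegrableOn (fun s : ℝ => |v| * (s ^ α * |Real.log (β * s)| * w s)) (Ioi 0) := ha.const_mul |v|
  have g12 : IntegrableOn (fun s : ℝ => ε * (s ^ α * |Real.log (β * s)| * w s) + (ε * Real.log β) * (s ^ α * w s)) (Ioi 0) := g1.add g2
  have g123 : IntegrableOn (fun s : ℝ => ε * (s ^ α * |Real.log (β * s)| * w s) + (ε * Real.log β) * (s ^ α * w s) + C * (s ^ (α + 1) * w s)) (Ioi 0) :=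
    g12.add g3
  rw [integral_add g123 g4, integral_add g12 g3, integral_add g1 g2, integral_const_mul, integral_const_mul, integral_const_mul,
    integral_const_mul, hJabs, hΓ0, hJ1]
  ring

/-! ## §10 The limit form with one logarithm -/

/-- Far-part bound: for `0 < δ ≤ 1/2 < … `, `δ < s`, `0 ≤ m ≤ M`:
`|m − v·s^α·log(s⁻¹)| ≤ (M·δ^{−(α+1)} + |v|·(1 + log δ⁻¹·δ⁻¹))·s^{α+1}`. [folklore] -/
theorem far_log_bound {M v α δ s m : ℝ} (hα : 0 < α) (hδ0 : 0 < δ) (hδ1 : δ ≤ 1 / 2) (h : δ < s) (hm0 : 0 ≤ m) (hmM : m ≤ M) :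
    |m - v * s ^ α * Real.log s⁻¹| ≤ (M * δ ^ (-(α + 1)) + |v| * (1 + Real.log δ⁻¹ * δ⁻¹)) * s ^ (α + 1) := by
  have hs : 0 < s := lt_trans hδ0 h
  have hsα : 0 < s ^ α := Real.rpow_pos_of_pos hs _
  have hlogδ : 0 ≤ Real.log δ⁻¹ := Real.log_nonneg (by rw [le_inv_comm₀ one_pos hδ0, inv_one]; linarith)
  have hδp : 0 < δ ^ (α + 1) := Real.rpow_pos_of_pos hδ0 _
  have hone : (1:ℝ) ≤ δ ^ (-(α + 1)) * s ^ (α + 1) := by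
    have h1 : δ ^ (α + 1) ≤ s ^ (α + 1) := Real.rpow_le_rpow hδ0.le h.le (by linarith)
    have h2 : δ ^ (-(α + 1)) * δ ^ (α + 1) = 1 := by rw [Real.rpow_neg hδ0.le, inv_mul_cancel₀ hδp.ne']
    calc (1:ℝ) = δ ^ (-(α + 1)) * δ ^ (α + 1) := h2.symm
      _ ≤ δ ^ (-(α + 1)) * s ^ (α + 1) := mul_le_mul_of_nonneg_left h1 (Real.rpow_nonneg hδ0.le _)
  have hsa1 : s ^ (α + 1) = s ^ α * s := by rw [Real.rpow_add hs, Real.rpow_one]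
  have hlogs : |Real.log s| ≤ (1 + Real.log δ⁻¹ * δ⁻¹) * s := by
    rcases le_or_gt 1 s with h1 | h1
    · rw [abs_of_nonneg (Real.log_nonneg h1)]
      have := Real.log_le_sub_one_of_pos hs
      nlinarith [mul_nonneg hlogδ (inv_nonneg.2 hδ0.le)]
    · rw [abs_of_neg (Real.log_neg hs h1)]
      have h2 : -Real.log s ≤ Real.log δ⁻¹ := by
        rw [← Real.log_inv]; exact Real.log_le_log (inv_pos.2 hs) (by rw [inv_le_inv₀ hs hδ0]; exact h.le)
      have h3 : Real.log δ⁻¹ ≤ Real.log δ⁻¹ * δ⁻¹ * s := by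
        have : 1 ≤ δ⁻¹ * s := by rw [inv_mul_eq_div, one_le_div hδ0]; exact h.le
        nlinarith
      nlinarith
  calc |m - v * s ^ α * Real.log s⁻¹| ≤ |m| + |v * s ^ α * Real.log s⁻¹| := abs_sub _ _
    _ = m + |v| * s ^ α * |Real.log s| := by rw [abs_of_nonneg hm0, abs_mul, abs_mul, abs_of_pos hsα, Real.log_inv, abs_neg]
    _ ≤ M * (δ ^ (-(α + 1)) * s ^ (α + 1)) + |v| * s ^ α * ((1 + Real.log δ⁻¹ * δ⁻¹) * s) :=
        add_le_add (by nlinarith) (mul_le_mul_of_nonneg_left hlogs (by positivity))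
    _ = _ := by rw [hsa1]; ring

/-- Near-part bound: if `|m/(s^α log s⁻¹) − v| ≤ η` with `0 < s < 1` then `|m − v·s^α·log s⁻¹| ≤ η·s^α·|log s|`. [folklore] -/
theorem near_log_bound {m v α η s : ℝ} (hs : 0 < s) (hs1 : s < 1) (h1 : |m / (s ^ α * Real.log s⁻¹) - v| ≤ η) :
    |m - v * s ^ α * Real.log s⁻¹| ≤ η * s ^ α * |Real.log s| := by
  have hsα : 0 < s ^ α := Real.rpow_pos_of_pos hs _
  have hlog : 0 < Real.log s⁻¹ := Real.log_pos (by rw [lt_inv_comm₀ one_pos hs, inv_one]; exact hs1)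
  have habs : |Real.log s| = Real.log s⁻¹ := by rw [Real.log_inv, abs_of_neg (Real.log_neg hs hs1)]
  have hden : 0 < s ^ α * Real.log s⁻¹ := mul_pos hsα hlog
  have e1 : m - v * s ^ α * Real.log s⁻¹ = (m / (s ^ α * Real.log s⁻¹) - v) * (s ^ α * Real.log s⁻¹) := by
    rw [sub_mul, div_mul_cancel₀ _ hden.ne']; ring
  rw [e1, abs_mul, abs_of_pos hden, habs]
  calc |m / (s ^ α * Real.log s⁻¹) - v| * (s ^ α * Real.log s⁻¹) ≤ η * (s ^ α * Real.log s⁻¹) := mul_le_mul_of_nonneg_right h1 hden.le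
    _ = η * s ^ α * Real.log s⁻¹ := by ring

/-- ★★★ **ABELIAN THEOREM WITH ONE LOGARITHM, LIMIT FORM**: for a finite measure `μ`, a measurable `G ≥ 0`, `α > 0`, and
`μ{G ≤ s}/(s^α·log(s⁻¹)) → v` as `s → 0⁺`: `β^α·∫e^{−βG}dμ / log β → v·Γ(α+1)` as `β → ∞`. [folklore] -/
theorem tendsto_laplace_abelian_log (μ : Measure Ω) [IsFiniteMeasure μ] {G : Ω → ℝ} (hG : Measurable G) (hG0 : ∀ ω, 0 ≤ G ω)
    {α v : ℝ} (hα : 0 < α) (hlim : Tendsto (fun s : ℝ => (μ {ω | G ω ≤ s}).toReal / (s ^ α * Real.log s⁻¹)) (𝓝[>] 0) (𝓝 v)) :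
    Tendsto (fun β : ℝ => β ^ α * (∫ ω, Real.exp (-(β * G ω)) ∂μ) / Real.log β) atTop (𝓝 (v * Real.Gamma (α + 1))) := by
  set M : ℝ := (μ univ).toReal with hM
  have hM0 : 0 ≤ M := ENNReal.toReal_nonneg
  have hm0 : ∀ s, 0 ≤ (μ {ω | G ω ≤ s}).toReal := fun s => ENNReal.toReal_nonneg
  have hmM : ∀ s, (μ {ω | G ω ≤ s}).toReal ≤ M := fun s => ENNReal.toReal_mono (measure_ne_top μ _) (measure_mono (subset_univ _))
  have hΓ : 0 < Real.Gamma (α + 1) := Real.Gamma_pos_of_pos (by linarith)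
  have hΓ2 : 0 < Real.Gamma (α + 1 + 1) := Real.Gamma_pos_of_pos (by linarith)
  have hc' := logMomentAbs_nonneg α
  rw [Metric.tendsto_atTop]
  intro e he
  set η : ℝ := e / (4 * Real.Gamma (α + 1)) with hη
  have hη0 : 0 < η := by positivity
  have hev : ∀ᶠ s in 𝓝[>] (0:ℝ), |(μ {ω | G ω ≤ s}).toReal / (s ^ α * Real.log s⁻¹) - v| < η := by
    have := (Metric.tendsto_nhds.1 hlim) η hη0
    simpa only [Real.dist_eq] using this
  obtain ⟨δ₀, hδ₀, hδ₀'⟩ : ∃ δ₀ > 0, ∀ s, 0 < s → s < δ₀ → |(μ {ω | G ω ≤ s}).toReal / (s ^ α * Real.log s⁻¹) - v| < η := by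
    rw [Filter.Eventually, mem_nhdsGT_iff_exists_Ioo_subset] at hev
    obtain ⟨u, hu, hsub⟩ := hev
    exact ⟨u, hu, fun s hs hsu => hsub ⟨hs, hsu⟩⟩
  set δ : ℝ := min (δ₀ / 2) (1 / 2) with hδ
  have hδ0 : 0 < δ := by positivity
  have hδ1 : δ ≤ 1 / 2 := min_le_right _ _
  have hδδ₀ : δ < δ₀ := by have := min_le_left (δ₀ / 2) (1 / 2); linarith
  set C : ℝ := M * δ ^ (-(α + 1)) + |v| * (1 + Real.log δ⁻¹ * δ⁻¹) with hC
  have hlogδ : 0 ≤ Real.log δ⁻¹ := Real.log_nonneg (by rw [le_inv_comm₀ one_pos hδ0, inv_one]; linarith)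
  have hC0 : 0 ≤ C := by positivity
  have hm : ∀ s : ℝ, 0 < s → |(μ {ω | G ω ≤ s}).toReal - v * s ^ α * Real.log s⁻¹| ≤ η * s ^ α * |Real.log s| + C * s ^ (α + 1) := by
    intro s hs
    have hpos1 : 0 ≤ η * s ^ α * |Real.log s| := by have := Real.rpow_nonneg hs.le α; positivity
    have hpos2 : 0 ≤ C * s ^ (α + 1) := mul_nonneg hC0 (Real.rpow_nonneg hs.le _)
    rcases le_or_gt s δ with h | h
    · have h1 := near_log_bound (v := v) hs (by linarith) (hδ₀' s hs (lt_of_le_of_lt h hδδ₀)).le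
      linarith
    · have h1 := far_log_bound (v := v) hα hδ0 hδ1 h (hm0 s) (hmM s)
      rw [← hC] at h1
      linarith
  -- the constant part `D` and the choice of `β`
  set D : ℝ := η * logMomentAbs α + |v| * logMomentAbs α + C * Real.Gamma (α + 1 + 1) with hD
  have hD0 : 0 ≤ D := by positivity
  refine ⟨max (Real.exp 1) (Real.exp (2 * D / e + 1)), fun β hβ => ?_⟩
  have hβe : Real.exp 1 ≤ β := le_trans (le_max_left _ _) hβ
  have hβ1 : 1 ≤ β := le_trans (by have := Real.add_one_le_exp (1:ℝ); linarith) hβe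
  have hβ0 : 0 < β := by linarith
  have hlog1 : 1 ≤ Real.log β := by rw [← Real.log_exp 1]; exact Real.log_le_log (Real.exp_pos _) hβe
  have hlog0 : 0 < Real.log β := by linarith
  have hlogD : 2 * D / e + 1 ≤ Real.log β := by
    rw [← Real.log_exp (2 * D / e + 1)]; exact Real.log_le_log (Real.exp_pos _) (le_trans (le_max_right _ _) hβ)
  have hcore := laplace_abelian_log_core μ hG hG0 hα hη0.le hm hβ1
  rw [Real.dist_eq]
  have e1 : β ^ α * (∫ ω, Real.exp (-(β * G ω)) ∂μ) / Real.log β - v * Real.Gamma (α + 1) =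
      (β ^ α * ∫ ω, Real.exp (-(β * G ω)) ∂μ - v * Real.Gamma (α + 1) * Real.log β) / Real.log β := by
    rw [sub_div, mul_div_assoc, mul_div_cancel_right₀ _ hlog0.ne']
  rw [e1, abs_div, abs_of_pos hlog0, div_lt_iff₀ hlog0]
  have hβinv : C * Real.Gamma (α + 1 + 1) * β⁻¹ ≤ C * Real.Gamma (α + 1 + 1) := by
    have : β⁻¹ ≤ 1 := inv_le_one_of_one_le₀ hβ1
    have h0 : 0 ≤ C * Real.Gamma (α + 1 + 1) := by positivity
    nlinarith
  have hDlog : D ≤ e / 2 * Real.log β := by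
    have : 2 * D / e ≤ Real.log β := by linarith
    rw [div_le_iff₀ he] at this; linarith
  have hηΓ : η * Real.Gamma (α + 1) = e / 4 := by rw [hη]; field_simp
  calc |β ^ α * ∫ ω, Real.exp (-(β * G ω)) ∂μ - v * Real.Gamma (α + 1) * Real.log β|
      ≤ η * (Real.Gamma (α + 1) * Real.log β + logMomentAbs α) + |v| * logMomentAbs α + C * Real.Gamma (α + 1 + 1) * β⁻¹ := hcore
    _ ≤ η * Real.Gamma (α + 1) * Real.log β + D := by rw [hD]; nlinarith
    _ = e / 4 * Real.log β + D := by rw [hηΓ]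
    _ < e * Real.log β := by nlinarith

end Summit.QuantumFields.YangMills.Theorems.SwapVirialDeficit.Abelian

end
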